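import Summits.Ventures.PercRepro.Night2TwoOneFatFaces

/-!
# PercRepro — the cell `(2, 1)` with two fat closures: when every thin member is fat, nothing is lost
(night-2, gen 28)

With at most two fat closures `H₀`, `H₁`, if EVERY thin member misses exactly two points, every thin covering preimage
of a covering set `Q` has closure `H₀` or `H₁`, and two preimages with the same closure `H` would put `Q` inside `H`
(rank `5 < 6`): at most two thin preimages, `L1 Q ≤ 7/12 < 11/18 ≤ capS Q`, no loss, (LI_G)
(**`localShadowHall_two_one_five_all_fat`**).  In the spread regime this is the case at `|V| ≤ 8`: a thin member
misses at most `n − 4 ≤ 4 < 7` points (**`localShadowHall_two_one_five_small`**).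
-/

namespace PercRepro.Shadow

open Finset PerFlat ThmH

variable {α : Type*} [DecidableEq α] {M : Matroid α} [M.Finite]

section AllFat

variable {G : Finset α}

open scoped Classical in
/-- **EVERY LOSS VANISHES WHEN EVERY THIN MEMBER IS FAT** (two fat closures `H₀ ≠ H₁`, at most two fat closures). -/
theorem loss_eq_zero_of_all_fat (hG : G ∈ flatsQ M (5 + 1)) (hd : (gr M \ G).card = 2)
    (hk : kColoops M G = 1) {B₀ B₁ : Finset α} (hB₀ : B₀ ∈ thinMembers M 5 G) (hB₁ : B₁ ∈ thinMembers M 5 G)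
    (hm₀ : (G \ clF M B₀).card ≤ 2) (hm₁ : (G \ clF M B₁).card ≤ 2) (hne : clF M B₀ ≠ clF M B₁)
    (hfat : (fatClosures M 5 G 2).card ≤ 2) (hall : ∀ B ∈ thinMembers M 5 G, (G \ clF M B).card ≤ 2)
    {B : Finset α} (hB : B ∈ thinMembers M 5 G) {z : α} (hz : z ∈ G \ clF M B) : loss M 5 G B z = 0 := by
  have hd' : (gr M \ G).card ≤ 5 := by omega
  have hB' : B ∈ membersIn M (Uq M (5 + 2) 5) G := (mem_thinMembers.1 hB).1
  have hBU : B ∈ Uq M (5 + 2) 5 := (mem_membersIn.1 hB').1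
  have hBG : B ⊆ G := (subset_clF hBU).trans (mem_membersIn.1 hB').2
  set Q := insert z B with hQ
  have hQG : Q ⊆ G := Finset.insert_subset (Finset.mem_sdiff.1 hz).1 hBG
  have hQ6 : rkN M Q = 6 := rkN_insert_eq_six_of_thin hG hB hz
  set Pre := (coverPreimages M (Uq M (5 + 2) 5) G Q).filter (fun B => B ∉ lay0 M 5 G) with hPre
  have hthin : ∀ F ∈ Pre, F ∈ thinMembers M 5 G := by
    intro F hF
    rw [hPre, Finset.mem_filter, mem_coverPreimages] at hF
    exact mem_thinMembers.2 ⟨hF.1.1, hF.2⟩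
  have hface : ∀ F ∈ Pre, ∃ w ∈ Q, Q.erase w = F := by
    intro F hF
    have h1 := thin_coverPreimages_subset_image_coloops hG hd' Q hF
    obtain ⟨w, hw, rfl⟩ := Finset.mem_image.1 h1
    exact ⟨w, (Finset.mem_sdiff.1 (mem_coloops.1 hw).1).1, rfl⟩
  -- two preimages with the same closure put `Q` inside it
  have hinj : ∀ F₁ ∈ Pre, ∀ F₂ ∈ Pre, clF M F₁ = clF M F₂ → F₁ = F₂ := by
    intro F₁ hF₁ F₂ hF₂ hcl
    by_contra hne12
    obtain ⟨w₁, hw₁, rfl⟩ := hface F₁ hF₁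
    obtain ⟨w₂, hw₂, rfl⟩ := hface F₂ hF₂
    have hw12 : w₁ ≠ w₂ := fun h => hne12 (by rw [h])
    have hF₁U : Q.erase w₁ ∈ Uq M (5 + 2) 5 := (mem_membersIn.1 (mem_thinMembers.1 (hthin _ hF₁)).1).1
    have hF₂U : Q.erase w₂ ∈ Uq M (5 + 2) 5 := (mem_membersIn.1 (mem_thinMembers.1 (hthin _ hF₂)).1).1
    have hQsub : Q ⊆ clF M (Q.erase w₁) := by
      intro x hx
      by_cases hxw : x = w₁
      · rw [hcl]
        apply subset_clF hF₂U
        exact Finset.mem_erase.2 ⟨hxw ▸ hw12, hx⟩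
      · exact subset_clF hF₁U (Finset.mem_erase.2 ⟨hxw, hx⟩)
    have h1 := rkN_mono (M := M) hQsub
    rw [hQ6, rkN_clF_eq_five_of_mem_Uq hF₁U] at h1
    omega
  have hPre2 : Pre.card ≤ 2 := by
    have hmap : ∀ F ∈ Pre, clF M F ∈ ({clF M B₀, clF M B₁} : Finset (Finset α)) := by
      intro F hF
      rw [Finset.mem_insert, Finset.mem_singleton]
      exact clF_eq_or_eq_of_fat hB₀ hB₁ hm₀ hm₁ hne hfat (hthin F hF) (hall F (hthin F hF))
    have := Finset.card_le_card_of_injOn (clF M) (fun F hF => hmap F hF)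
      (fun F₁ hF₁ F₂ hF₂ h => hinj F₁ hF₁ F₂ hF₂ h)
    have h2 : ({clF M B₀, clF M B₁} : Finset (Finset α)).card ≤ 2 := Finset.card_le_two
    omega
  have hL1 : L1 M 5 G Q ≤ 7 / 12 := by
    unfold L1
    rw [← hPre]
    calc ∑ F ∈ Pre, req M 5 F ≤ ∑ _F ∈ Pre, (7 / 24 : ℚ) :=
          Finset.sum_le_sum (fun F hF => req_le_of_thin_two_one hG hd (hthin F hF))
      _ = (Pre.card : ℚ) * (7 / 24) := by rw [Finset.sum_const, nsmul_eq_mul]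
      _ ≤ 2 * (7 / 24) := by
          have : (Pre.card : ℚ) ≤ 2 := by exact_mod_cast hPre2
          nlinarith
      _ = 7 / 12 := by norm_num
  have hcap := capS_ge_eleven_eighteenths_two_one hd hk hQG
  have hfS : fS M 5 G Q = 1 := by
    unfold fS
    rw [if_pos (by linarith)]
  unfold loss
  rw [← hQ, hfS]
  ring

open scoped Classical in
/-- **(LI_G) WHEN EVERY THIN MEMBER IS FAT** (two fat closures, at most two). -/
theorem localShadowHall_two_one_five_all_fat (hG : G ∈ flatsQ M (5 + 1)) (hd : (gr M \ G).card = 2)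
    (hk : kColoops M G = 1) {B₀ B₁ : Finset α} (hB₀ : B₀ ∈ thinMembers M 5 G) (hB₁ : B₁ ∈ thinMembers M 5 G)
    (hm₀ : (G \ clF M B₀).card ≤ 2) (hm₁ : (G \ clF M B₁).card ≤ 2) (hne : clF M B₀ ≠ clF M B₁)
    (hfat : (fatClosures M 5 G 2).card ≤ 2) (hall : ∀ B ∈ thinMembers M 5 G, (G \ clF M B).card ≤ 2) :
    LocalShadowHall M 5 G := by
  apply localShadowHall_of_loss_eq_zero hG (by omega)
  intro B hB z hz
  exact loss_eq_zero_of_all_fat hG hd hk hB₀ hB₁ hm₀ hm₁ hne hfat hall hB hz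

/-- A thin member of the cell misses at most `|V| − 4` points (its closure has `≥ 5` points, `|K| = 1`). -/
theorem card_sdiff_clF_le_of_thin (hk : kColoops M G = 1) {B : Finset α}
    (hB : B ∈ thinMembers M 5 G) : (G \ clF M B).card + 4 ≤ (G \ coloops M G).card := by
  have hB' : B ∈ membersIn M (Uq M (5 + 2) 5) G := (mem_thinMembers.1 hB).1
  have hBU : B ∈ Uq M (5 + 2) 5 := (mem_membersIn.1 hB').1
  have hHG : clF M B ⊆ G := (mem_membersIn.1 hB').2
  have h5 : 5 ≤ (clF M B).card := by
    have := rkN_le_card (M := M) (clF M B)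
    rw [rkN_clF_eq_five_of_mem_Uq hBU] at this
    exact this
  have hKG : coloops M G ⊆ G := fun y hy => (mem_coloops.1 hy).1
  have hK1 : (coloops M G).card = 1 := by rw [← kColoops_eq_card_coloops]; exact hk
  have h1 := Finset.card_sdiff_of_subset hHG
  have h2 := Finset.card_sdiff_of_subset hKG
  have h3 := Finset.card_le_card hHG
  have h4 := Finset.card_le_card hKG
  omega

open scoped Classical in
/-- **THE SPREAD REGIME AT `|V| ≤ 8` IS LOSSLESS**: every thin member misses `≤ 4 < 7` points, hence exactly two. -/
theorem localShadowHall_two_one_five_small (hG : G ∈ flatsQ M (5 + 1)) (hd : (gr M \ G).card = 2)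
    (hk : kColoops M G = 1) {B₀ B₁ : Finset α} (hB₀ : B₀ ∈ thinMembers M 5 G) (hB₁ : B₁ ∈ thinMembers M 5 G)
    (hm₀ : (G \ clF M B₀).card ≤ 2) (hm₁ : (G \ clF M B₁).card ≤ 2) (hne : clF M B₀ ≠ clF M B₁)
    (hfat : (fatClosures M 5 G 2).card ≤ 2)
    (hsp : ∀ B ∈ thinMembers M 5 G, 2 < (G \ clF M B).card → 7 ≤ (G \ clF M B).card)
    (h8 : (G \ coloops M G).card ≤ 8) : LocalShadowHall M 5 G := by
  apply localShadowHall_two_one_five_all_fat hG hd hk hB₀ hB₁ hm₀ hm₁ hne hfat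
  intro B hB
  have h1 := card_sdiff_clF_le_of_thin hk hB
  by_contra h
  push Not at h
  have := hsp B hB h
  omega

end AllFat

end PercRepro.Shadow
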